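import Mathlib.MeasureTheory.Constructions.Pi
import Mathlib.MeasureTheory.Measure.Lebesgue.Basic
import Mathlib.MeasureTheory.Measure.WithDensity
import Mathlib.MeasureTheory.Integral.Bochner.Basic
import Mathlib.Analysis.SpecialFunctions.Exp
import Mathlib.Analysis.SpecialFunctions.Complex.Circle
import Mathlib.Data.Finsupp.Basic
import Literature.Probability.LatticeModels.DomainDiscretisation
import HarnessLib

/-!
# The discrete Gaussian free field on the FACES of a discrete planar domain (zero boundary data)

Topic `Literature/Probability/RandomPlanarGeometry` (definition request `defn-faceDGFF` of route
`SAWDiscreteFlowLine`, summit `CriticalPhenomena/SAWScalingLimit`). For a planar domain `Ω ⊆ ℂ` and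
a mesh `δ`, the discrete domain `Ω_δ ⊆ δℤ²` is the tree's `discreteDomainGraph Ω δ`
(`Literature/Probability/LatticeModels/DomainDiscretisation.lean`); its FACES are the unit squares
of `ℤ²` all four of whose sides are edges of `Ω_δ`, indexed by their lower-left corner (so the face
set is again a subset of `Site 2 = ℤ²`, the dual lattice shifted by `(½, ½)`). On the faces one puts
the zero-Dirichlet discrete Gaussian free field with the SIMPLE-RANDOM-WALK normalisation: the
centred Gaussian vector `(h_f)_{f ∈ F}` whose covariance is the Green function of simple random
walk on the dual lattice killed when it leaves `F`,
`G_F(f, g) = ∑_{n ≥ 0} P_f(X_n = g, n < τ_{F^c}) = ∑_{walks f → g inside F} 4^{-length}`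
(Schramm–Sheffield 2009, §1.2–1.3 "discrete Gaussian free field", with their Dirichlet-energy
normalisation differing by the constant discussed below; Lawler–Limic 2010, §4.6 and Prop. 4.6.2 for
the killed Green function as a walk sum and as `(I − P_F)⁻¹`).

## Contents (all definitions are the `let`s inlined in the cruxes `LatticeFlowLine`,
`FlowLineStability`, `GaussianDressing` of `Summits/CriticalPhenomena/SAWScalingLimit/Theses/SAWDiscreteFlowLine.lean`, verbatim)

* `faceDomain Ω δ` (`Fc`), `faceCentre δ f = meshPoint δ f + δ(1+i)/2` (`ctr`);
* `faceGreen A f g = ∑' ω : walk f → g in ℤ², [supp ω ⊆ A] 4^{-|ω|}` (`Gf`) and the exit/harmonic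
  measure kernel `faceExit A z f = ¼ ∑_{e unit} faceGreen A z (f + e)` (`Hm`: for `f ∉ A` adjacent to
  `A` this is `P_z(the killed walk exits A through f)`, and `f ↦ faceExit A z f` restricted to the
  outer boundary is the discrete harmonic measure from `z`);
* the pairings with a test function `ψ : ℂ → ℝ`: `facePairing Ω δ ψ w = ∑_{f ∈ Fc} δ² ψ(ctr f) w f`
  (`pr`, `⟨w, ψ⟩_δ`) and `faceQuadForm Ω δ ψ A = ∑_{f,g ∈ Fc} δ⁴ ψ(ctr f) ψ(ctr g) G_A(f,g)` (`Qv`,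
  `⟨ψ, G_A ψ⟩_δ`);
* `IsFaceDGFFLaw Ω δ μ` — the clause `gff δ μ` of the cruxes: `μ` is a probability measure on
  `Site 2 → ℝ` with `∫ exp(i ∑ t_f h_f) dμ = exp(−½ ∑ t_f t_g G_{Fc}(f,g))` for finitely supported `t`
  (the centred Gaussian law of covariance `G_{Fc}`, fields vanishing off `Fc`);
* `facePrecisionForm S h = ∑_{f∈S} (h_f² − ¼ ∑_e [f+e ∈ S] h_f h_{f+e}) = hᵀ (I − P_S) h` and the LAW
  `faceDGFF Ω δ : Measure (Site 2 → ℝ)`: for finite `Fc` the normalised measure with density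
  `exp(−½ hᵀ(I − P_{Fc})h)` w.r.t. Lebesgue on `ℝ^{Fc}`, pushed forward by extension by `0`
  (covariance `(I − P_{Fc})⁻¹ = G_{Fc}`, Lawler–Limic Prop. 4.6.2); junk `δ_0` when `Fc` is infinite.

Proved here: membership/unfolding lemmas, nonnegativity of `faceGreen`/`faceExit`, `faceDGFF` on an
unbounded (infinite-face) domain is the junk Dirac mass. NOT proved here (theorems for the `…Proofs`
companion, deliberately not stated as named facts, D-0026): `IsProbabilityMeasure (faceDGFF Ω δ)` and
the characteristic-function identity `IsFaceDGFFLaw Ω δ (faceDGFF Ω δ)` for bounded `Ω` (Gaussian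
integral + `G = (I − P)⁻¹`), the Markov property, `E[h_f h_g] = G(f,g)`.

## Normalisation note

With `P_S = ¼ A_S` (`A_S` the adjacency matrix of the faces inside `S`) the precision matrix is
`I − P_S = ¼ (4 I − A_S) = ¼ (−Δ_S^{Dirichlet})`, so `G = 4 (−Δ)⁻¹`: FOUR times the Green function of
the unit-conductance network (Schramm–Sheffield's `H¹`-normalised DGFF has covariance `(−Δ)⁻¹`),
which is why the cruxes carry Miller–Sheffield's constants through `κ₀ = √(π/2)`.

## References

* O. Schramm, S. Sheffield, *Contour lines of the two-dimensional discrete Gaussian free field*,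
  Acta Math. 202 (2009), §1.2–1.3. [SchrammSheffield2009]
* G. F. Lawler, V. Limic, *Random Walk: A Modern Introduction* (2010), §4.6, Prop. 4.6.2
  (Green function of the killed walk). [LawlerLimic2010]
* J. Miller, S. Sheffield, *Imaginary geometry I*, PTRF 164 (2016), Thm. 1.1 (constants).
  [MillerSheffield2016]
-/

noncomputable section

open MeasureTheory
open scoped Classical

namespace Literature.Probability.RandomPlanarGeometry

open Literature.Probability.LatticeModels

/-! ### Faces of the discrete domain -/

/-- The unit coordinate vectors `e₀ = (1,0)`, `e₁ = (0,1)` and the diagonal `(1,1)` of `ℤ²`, as used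
for faces. [folklore] -/
theorem site_e0_add_e1 : (![1, 0] : Site 2) + ![0, 1] = ![1, 1] := by
  ext i; fin_cases i <;> rfl

/-- **The faces of `Ω_δ`**: the unit squares `[f, f+e₀] × [f, f+e₁]` (indexed by the lower-left corner
`f ∈ ℤ²`) all four of whose sides `f—f+e₀`, `f—f+e₁`, `f+e₀—f+e₀+e₁`, `f+e₁—f+e₀+e₁` are edges of the
discrete domain graph `discreteDomainGraph Ω δ` (the `let Fc` of the cruxes of route
`SAWDiscreteFlowLine`). [cite: SchrammSheffield2009, §1.2] -/
def faceDomain (Ω : Set ℂ) (δ : ℝ) : Set (Site 2) :=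
  {f | (discreteDomainGraph Ω δ).Adj f (f + ![1, 0]) ∧ (discreteDomainGraph Ω δ).Adj f (f + ![0, 1]) ∧
    (discreteDomainGraph Ω δ).Adj (f + ![1, 0]) (f + ![1, 1]) ∧
      (discreteDomainGraph Ω δ).Adj (f + ![0, 1]) (f + ![1, 1])}

/-- Membership in `faceDomain`, unfolded. [cite: SchrammSheffield2009, §1.2] -/
theorem mem_faceDomain_iff {Ω : Set ℂ} {δ : ℝ} {f : Site 2} :
    f ∈ faceDomain Ω δ ↔
      (discreteDomainGraph Ω δ).Adj f (f + ![1, 0]) ∧ (discreteDomainGraph Ω δ).Adj f (f + ![0, 1]) ∧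
        (discreteDomainGraph Ω δ).Adj (f + ![1, 0]) (f + ![1, 1]) ∧
          (discreteDomainGraph Ω δ).Adj (f + ![0, 1]) (f + ![1, 1]) :=
  Iff.rfl

/-- **The centre of the face `f`**: `meshPoint δ f + δ (1 + i)/2 ∈ ℂ` (the `let ctr` of the cruxes).
[cite: SchrammSheffield2009, §1.2] -/
def faceCentre (δ : ℝ) (f : Site 2) : ℂ :=
  meshPoint δ f + (δ : ℂ) * (1 + Complex.I) / 2

/-- The face centre in coordinates: `δ (f₀ + ½) + i δ (f₁ + ½)`. [folklore] -/
theorem faceCentre_eq (δ : ℝ) (f : Site 2) :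
    faceCentre δ f = ⟨δ * (f 0 + 2⁻¹), δ * (f 1 + 2⁻¹)⟩ := by
  apply Complex.ext <;> simp [faceCentre] <;> ring

/-! ### The Green function of the killed walk and the exit kernel -/

/-- **The Green function of simple random walk on `ℤ²` killed off `A`**, as a walk sum:
`G_A(f, g) = ∑_{ω : f → g nearest-neighbour walk, supp ω ⊆ A} 4^{-length ω}` — the expected number of
visits to `g` before leaving `A` of the walk started at `f` (`= ((I − P_A)⁻¹)_{fg}`, `P_A = ¼ A_A`),
the covariance of the face DGFF (the `let Gf` of the cruxes; a `tsum`, summable when `A` is finite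
— the killed walk then leaves `A` with a geometric tail — and given the junk value `0` when not
summable, e.g. `A = ℤ²`, where the walk is recurrent; `G_A(f, g) = 0` unless `f, g ∈ A`, since every
walk `f → g` visits `f` and `g`). [cite: LawlerLimic2010, §4.6 Prop. 4.6.2] -/
def faceGreen (A : Set (Site 2)) (f g : Site 2) : ℝ :=
  ∑' ω : (zdGraph 2).Walk f g, if (∀ x ∈ ω.support, x ∈ A) then ((4 : ℝ)⁻¹) ^ ω.length else 0

/-- The summands of `faceGreen` are nonnegative. [folklore] -/
theorem faceGreen_summand_nonneg (A : Set (Site 2)) {f g : Site 2} (ω : (zdGraph 2).Walk f g) :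
    0 ≤ (if (∀ x ∈ ω.support, x ∈ A) then ((4 : ℝ)⁻¹) ^ ω.length else 0) := by
  split_ifs <;> positivity

/-- `G_A(f, g) ≥ 0`. [cite: LawlerLimic2010, §4.6] -/
theorem faceGreen_nonneg (A : Set (Site 2)) (f g : Site 2) : 0 ≤ faceGreen A f g :=
  tsum_nonneg (faceGreen_summand_nonneg A)

/-- **The exit (harmonic-measure) kernel** `H_A(z, f) = ¼ ∑_{e ∈ {±e₀, ±e₁}} G_A(z, f + e)`: for a
face `f` outside `A` this is the probability that the walk from `z` killed off `A` makes its first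
step out of `A` INTO `f` (last-exit decomposition), i.e. the discrete harmonic measure of `f` seen from
`z` in `A`; `u ↦ ∑_f H_A(·, f) u(f)` is the discrete harmonic extension to `A` of boundary data `u`
(the `let Hm` of the cruxes). [cite: LawlerLimic2010, §4.6 and §6.1] -/
def faceExit (A : Set (Site 2)) (z f : Site 2) : ℝ :=
  (faceGreen A z (f + ![1, 0]) + faceGreen A z (f + ![-1, 0]) + faceGreen A z (f + ![0, 1]) +
    faceGreen A z (f + ![0, -1])) / 4

/-- `H_A(z, f) ≥ 0`. [cite: LawlerLimic2010, §4.6] -/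
theorem faceExit_nonneg (A : Set (Site 2)) (z f : Site 2) : 0 ≤ faceExit A z f := by
  unfold faceExit
  have h := faceGreen_nonneg A z
  exact div_nonneg (add_nonneg (add_nonneg (add_nonneg (h _) (h _)) (h _)) (h _)) (by norm_num)

/-! ### Pairings with test functions -/

/-- **The lattice pairing** `⟨w, ψ⟩_δ = ∑_{f ∈ Fc} δ² ψ(centre f) w(f)` of a face function `w` with a
test function `ψ : ℂ → ℝ` (Riemann sum of `∫ ψ w`; the `let pr` of the cruxes; `tsum` over `ℤ²` of a
function supported on `faceDomain Ω δ`). [cite: SchrammSheffield2009, §1.3] -/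
def facePairing (Ω : Set ℂ) (δ : ℝ) (ψ : ℂ → ℝ) (w : Site 2 → ℝ) : ℝ :=
  ∑' f : Site 2, if f ∈ faceDomain Ω δ then δ ^ 2 * ψ (faceCentre δ f) * w f else 0

/-- **The Green quadratic form** `⟨ψ, G_A ψ⟩_δ = ∑_{f, g ∈ Fc} δ⁴ ψ(centre f) ψ(centre g) G_A(f, g)`
(the variance of `⟨h, ψ⟩_δ` for the DGFF killed off `A`; the `let Qv` of the cruxes).
[cite: SchrammSheffield2009, §1.3] -/
def faceQuadForm (Ω : Set ℂ) (δ : ℝ) (ψ : ℂ → ℝ) (A : Set (Site 2)) : ℝ :=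
  ∑' f : Site 2, ∑' g : Site 2,
    if f ∈ faceDomain Ω δ ∧ g ∈ faceDomain Ω δ then
      δ ^ 4 * ψ (faceCentre δ f) * ψ (faceCentre δ g) * faceGreen A f g else 0

/-! ### The law: characterisation and construction -/

/-- **The face-DGFF law, characterised** (the clause `gff δ μ` of the cruxes of route
`SAWDiscreteFlowLine`): `μ` is a probability measure on fields `h : ℤ² → ℝ` whose finite-dimensional
characteristic functions are those of the centred Gaussian vector with covariance
`G_{Fc}` (`Fc = faceDomain Ω δ`): `∫ exp(i ∑_{f ∈ supp t} t_f h_f) dμ(h) = exp(−½ ∑_{f,g} t_f t_g G_{Fc}(f,g))`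
for every finitely supported `t`; in particular `h_f = 0` a.s. for `f ∉ Fc` (its variance
`G_{Fc}(f, f)` vanishes). [cite: SchrammSheffield2009, §1.3] -/
def IsFaceDGFFLaw (Ω : Set ℂ) (δ : ℝ) (μ : Measure (Site 2 → ℝ)) : Prop :=
  IsProbabilityMeasure μ ∧
    ∀ t : Site 2 →₀ ℝ,
      ∫ h, Complex.exp (Complex.I * ((∑ f ∈ t.support, t f * h f : ℝ) : ℂ)) ∂μ =
        Complex.exp (-((∑ f ∈ t.support, ∑ g ∈ t.support, t f * t g * faceGreen (faceDomain Ω δ) f g : ℝ) : ℂ) / 2)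

/-- A face-DGFF law is a probability measure. [cite: SchrammSheffield2009, §1.3] -/
theorem IsFaceDGFFLaw.isProbabilityMeasure {Ω : Set ℂ} {δ : ℝ} {μ : Measure (Site 2 → ℝ)}
    (h : IsFaceDGFFLaw Ω δ μ) : IsProbabilityMeasure μ :=
  h.1

/-- The four unit steps `±e₀, ±e₁` of `ℤ²`. [folklore] -/
def unitSteps : Finset (Site 2) :=
  {![1, 0], ![-1, 0], ![0, 1], ![0, -1]}

/-- **The Dirichlet precision form** of the killed walk on a finite face set `S`:
`Q_S(h) = ∑_{f ∈ S} (h_f² − ¼ ∑_{e} [f + e ∈ S] h_f h_{f+e}) = hᵀ (I − P_S) h`, `P_S = ¼`(adjacency inside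
`S`); `(I − P_S)⁻¹ = G_S` (Lawler–Limic Prop. 4.6.2), and `I − P_S = ¼(−Δ_S)` with Dirichlet boundary
condition. [cite: LawlerLimic2010, §4.6 Prop. 4.6.2] -/
def facePrecisionForm (S : Finset (Site 2)) (h : Site 2 → ℝ) : ℝ :=
  ∑ f ∈ S, (h f ^ 2 - (4 : ℝ)⁻¹ * ∑ e ∈ unitSteps, if f + e ∈ S then h f * h (f + e) else 0)

/-- Extension by zero of a function on a finite face set to a field on `ℤ²`. [folklore] -/
def extendByZero (S : Finset (Site 2)) (x : S → ℝ) : Site 2 → ℝ :=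
  fun f => if hf : f ∈ S then x ⟨f, hf⟩ else 0

/-- `extendByZero` vanishes off `S`. [folklore] -/
theorem extendByZero_of_not_mem {S : Finset (Site 2)} (x : S → ℝ) {f : Site 2} (hf : f ∉ S) :
    extendByZero S x f = 0 := by
  simp [extendByZero, hf]

/-- `extendByZero` restricts back to `x` on `S`. [folklore] -/
theorem extendByZero_apply_mem {S : Finset (Site 2)} (x : S → ℝ) (f : S) :
    extendByZero S x f = x f := by
  simp [extendByZero, f.2]

/-- **The zero-boundary face DGFF of `Ω_δ`** as a law on fields `ℤ² → ℝ` (product σ-algebra): when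
the face set `Fc = faceDomain Ω δ` is finite (e.g. `Ω` bounded, `δ > 0`), the probability measure on
`ℝ^{Fc}` with density proportional to `exp(−½ hᵀ (I − P_{Fc}) h)` with respect to Lebesgue measure —
the centred Gaussian vector of covariance `(I − P_{Fc})⁻¹ = G_{Fc}` (`faceGreen`), i.e. the DGFF with
the simple-random-walk normalisation — pushed forward along extension by zero; the junk value `δ_0`
(the zero field) when `Fc` is infinite. Its characterisation `IsFaceDGFFLaw Ω δ (faceDGFF Ω δ)` for
finite `Fc` is the Gaussian characteristic-function computation (companion proof file).
[cite: SchrammSheffield2009, §1.2–1.3] -/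
def faceDGFF (Ω : Set ℂ) (δ : ℝ) : Measure (Site 2 → ℝ) :=
  if hS : (faceDomain Ω δ).Finite then
    let S : Finset (Site 2) := hS.toFinset
    let ν : Measure (S → ℝ) :=
      volume.withDensity fun x => ENNReal.ofReal (Real.exp (-(facePrecisionForm S (extendByZero S x)) / 2))
    ((ν Set.univ)⁻¹ • ν).map (extendByZero S)
  else Measure.dirac 0

/-- On an infinite face set the definition returns its documented junk value `δ_0`. [folklore] -/
theorem faceDGFF_of_infinite {Ω : Set ℂ} {δ : ℝ} (h : ¬ (faceDomain Ω δ).Finite) :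
    faceDGFF Ω δ = Measure.dirac 0 := by
  rw [faceDGFF, dif_neg h]

end Literature.Probability.RandomPlanarGeometry
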